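import Literature.AlgebraicGeometry.HodgeTheory.CyclicReflectionEigenspaceSpan
import HarnessLib

/-!
# The invariant eigenspace `H(1) ⊗ ℂ = H(ζ^0)`: it is spanned by the rational invariants, and maps fixing
# the rational invariants (the monodromy group; commutators of `τ`-commuting maps when `dim H_ℚ(1) ≤ 1`)
# act trivially on it — lane D, hole S6 (the `H(1)` block of the section)

Family `hodge`, layer `Literature/AlgebraicGeometry/HodgeTheory`. THEOREMS only, for crux K1 of
`Summits/HodgeConjecture/HodgeConjecture/Theses/CyclicUnitaryPowers.lean` (lane D glue, hole S6: the block of the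
section on `H(1) ⊗ ℂ` is the identity).  `π_0 (1 ⊗ v) = 1 ⊗ (p⁻¹ Σ_i τ^i v)` with `p⁻¹ Σ τ^i v ∈ H_ℚ(1)`, so
`H(ζ^0) ⊆ span_ℂ (1 ⊗ H_ℚ(1))` (no flatness argument needed); hence a rational `γ` fixing `H_ℚ(1)` pointwise has
`γ ⊗ ℂ = id` on `H(ζ^0)`.  Cyclic reflections fix `H_ℚ(1)` (`cyclicReflection_apply_of_apply_eq_self`), and so
does the commutator of two `τ`-commuting automorphisms when `dim H_ℚ(1) ≤ 1`.
Written by the prover seat `hodge-nonav-prover-Ax`.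

## References
* [CarlsonToledo1999] J. A. Carlson, D. Toledo, Duke Math. J. 97 (1999), §6 (p. 13) (the invariant part), §2 (p. 5).
-/

noncomputable section

open Module Literature.AlgebraicGeometry.Motives
open scoped TensorProduct

namespace Literature.AlgebraicGeometry.HodgeTheory

universe v

variable {V : Type v} [AddCommGroup V] [Module ℚ V]

/-- **`π_0 (1 ⊗ v) = 1 ⊗ (p⁻¹ Σ_{i<p} τ^i v)`**: the projector onto `H(ζ^0) = H(1)` is the rational averaging
operator. [cite: CarlsonToledo1999, §6 (p. 13)] -/
theorem cyclicEigenProjector_zero_one_tmul (τ : V →ₗ[ℚ] V) (p : ℕ) (ζ : ℂ) (v : V) :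
    cyclicEigenProjector τ p ζ 0 ((1 : ℂ) ⊗ₜ[ℚ] v) =
      (1 : ℂ) ⊗ₜ[ℚ] ((p : ℚ)⁻¹ • ∑ i ∈ Finset.range p, (τ ^ i) v) := by
  rw [cyclicEigenProjector_apply]
  simp only [mul_zero, pow_zero, one_smul]
  have h : ∑ i ∈ Finset.range p, ((τ.baseChange ℂ) ^ i) ((1 : ℂ) ⊗ₜ[ℚ] v) =
      (1 : ℂ) ⊗ₜ[ℚ] (∑ i ∈ Finset.range p, (τ ^ i) v) := by
    rw [TensorProduct.tmul_sum]
    refine Finset.sum_congr rfl fun i _ => ?_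
    rw [← LinearMap.baseChange_pow, LinearMap.baseChange_tmul]
  rw [h, TensorProduct.tmul_smul, ← algebraMap_smul ℂ ((p : ℚ)⁻¹)]
  simp

/-- **`H(ζ^0) ⊆ span_ℂ (1 ⊗ H_ℚ(1))`**: the invariant eigenspace of `τ ⊗ ℂ` is spanned by the rational
`τ`-invariants (`τ^p = 1`, `ζ` primitive). [cite: CarlsonToledo1999, §6 (p. 13)] -/
theorem eigenspace_pow_zero_le_span_invariants {τ : V →ₗ[ℚ] V} {p : ℕ} (hτ : τ ^ p = 1) {ζ : ℂ}
    (hζ : IsPrimitiveRoot ζ p) (hp : 0 < p) :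
    Module.End.eigenspace (τ.baseChange ℂ) (ζ ^ 0) ≤
      Submodule.span ℂ ((fun w : V => (1 : ℂ) ⊗ₜ[ℚ] w) '' (Module.End.eigenspace τ 1 : Set V)) := by
  have hζ0 : ζ ≠ 0 := hζ.ne_zero hp.ne'
  intro x hx
  rw [← cyclicEigenProjector_apply_of_mem_eigenspace_self hp.ne' hζ0 0 hx]
  -- `π_0 z` lies in the span for every `z`
  have hall : ∀ z : ℂ ⊗[ℚ] V, cyclicEigenProjector τ p ζ 0 z ∈
      Submodule.span ℂ ((fun w : V => (1 : ℂ) ⊗ₜ[ℚ] w) '' (Module.End.eigenspace τ 1 : Set V)) := by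
    intro z
    induction z using TensorProduct.induction_on with
    | zero => rw [map_zero]; exact Submodule.zero_mem _
    | tmul a v =>
      rw [show a ⊗ₜ[ℚ] v = a • ((1 : ℂ) ⊗ₜ[ℚ] v) by rw [TensorProduct.smul_tmul', smul_eq_mul, mul_one], map_smul,
        cyclicEigenProjector_zero_one_tmul]
      refine Submodule.smul_mem _ _ (Submodule.subset_span ⟨_, ?_, rfl⟩)
      rw [SetLike.mem_coe, Module.End.mem_eigenspace_iff, one_smul, map_smul, apply_sum_pow_apply hτ]
    | add z w hz hw => rw [map_add]; exact Submodule.add_mem _ hz hw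
  exact hall x

/-- **A rational map fixing the `τ`-invariants fixes `H(ζ^0)` pointwise** after base change.
[cite: CarlsonToledo1999, §6 (p. 13)] -/
theorem baseChange_apply_eq_self_of_forall_invariant {τ γ : V →ₗ[ℚ] V} {p : ℕ} (hτ : τ ^ p = 1) {ζ : ℂ}
    (hζ : IsPrimitiveRoot ζ p) (hp : 0 < p) (hγ : ∀ v : V, τ v = v → γ v = v) {x : ℂ ⊗[ℚ] V}
    (hx : x ∈ Module.End.eigenspace (τ.baseChange ℂ) (ζ ^ 0)) : γ.baseChange ℂ x = x := by
  have hmem := eigenspace_pow_zero_le_span_invariants hτ hζ hp hx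
  have h := LinearMap.eqOn_span' (f := γ.baseChange ℂ) (g := LinearMap.id) ?_ hmem
  · simpa using h
  rintro _ ⟨w, hw, rfl⟩
  show γ.baseChange ℂ _ = LinearMap.id _
  rw [LinearMap.id_apply, LinearMap.baseChange_tmul,
    hγ w (by simpa [Module.End.mem_eigenspace_iff] using hw)]

/-- **When `dim H_ℚ(1) ≤ 1`, the commutator of two `τ`-commuting automorphisms fixes the `τ`-invariants**
(each acts on the invariant line by a scalar). [cite: CarlsonToledo1999, §6 (p. 13)] -/
theorem commutator_apply_eq_self_of_finrank_eigenspace_one_le_one [Module.Finite ℚ V] {τ : V →ₗ[ℚ] V}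
    (hfix : finrank ℚ (Module.End.eigenspace τ 1) ≤ 1) {g h : V ≃ₗ[ℚ] V}
    (hg : ∀ x, g (τ x) = τ (g x)) (hh : ∀ x, h (τ x) = τ (h x)) {v : V} (hv : τ v = v) :
    (g * h * g⁻¹ * h⁻¹) v = v := by
  -- `g`, `h` and their inverses preserve the invariants
  have hpres : ∀ f : V ≃ₗ[ℚ] V, (∀ x, f (τ x) = τ (f x)) → ∀ w : V, τ w = w → τ (f w) = f w := by
    intro f hf w hw
    rw [← hf, hw]
  have hpres_inv : ∀ f : V ≃ₗ[ℚ] V, (∀ x, f (τ x) = τ (f x)) → ∀ w : V, τ w = w → τ (f.symm w) = f.symm w := by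
    intro f hf w hw
    apply f.injective
    rw [hf, LinearEquiv.apply_symm_apply, hw]
  -- all invariants are multiples of a fixed `v₀`
  obtain ⟨v₀, hv₀⟩ := finrank_le_one_iff.1 hfix
  have hmul : ∀ w : V, τ w = w → ∃ c : ℚ, w = c • (v₀ : V) := by
    intro w hw
    obtain ⟨c, hc⟩ := hv₀ ⟨w, by simpa [Module.End.mem_eigenspace_iff] using hw⟩
    exact ⟨c, by simpa using congrArg Subtype.val hc.symm⟩
  have hv₀inv : τ (v₀ : V) = v₀ := by
    have h1 := Module.End.mem_eigenspace_iff.1 v₀.2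
    rwa [one_smul] at h1
  -- scalars of `g` and `h` on `v₀`
  obtain ⟨a, ha⟩ := hmul _ (hpres g hg _ hv₀inv)
  obtain ⟨b, hb⟩ := hmul _ (hpres h hh _ hv₀inv)
  obtain ⟨c, rfl⟩ := hmul v hv
  by_cases hc0 : (v₀ : V) = 0
  · simp [hc0]
  -- `a ≠ 0`, `b ≠ 0` (automorphisms), then compute
  have ha0 : a ≠ 0 := by
    rintro rfl
    rw [zero_smul] at ha
    exact hc0 (g.injective (by rw [ha, map_zero]))
  have hb0 : b ≠ 0 := by
    rintro rfl
    rw [zero_smul] at hb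
    exact hc0 (h.injective (by rw [hb, map_zero]))
  have hg' : (g⁻¹ : V ≃ₗ[ℚ] V) (v₀ : V) = a⁻¹ • (v₀ : V) := by
    show g.symm _ = _
    apply g.injective
    rw [LinearEquiv.apply_symm_apply, map_smul, ha, smul_smul, inv_mul_cancel₀ ha0, one_smul]
  have hh' : (h⁻¹ : V ≃ₗ[ℚ] V) (v₀ : V) = b⁻¹ • (v₀ : V) := by
    show h.symm _ = _
    apply h.injective
    rw [LinearEquiv.apply_symm_apply, map_smul, hb, smul_smul, inv_mul_cancel₀ hb0, one_smul]
  simp only [LinearEquiv.mul_apply, map_smul, hh', hg', ha, hb, smul_smul]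
  congr 1
  field_simp

end Literature.AlgebraicGeometry.HodgeTheory

end
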